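import Summits.CriticalPhenomena.PercolationContinuityZ3.Theorems.PercNearOneGluingNoHeavyLowerTailSahiCombFiveUpSetPassage

/-!
# A universal Kleitman matching, part III: the SANDWICH form of the three-set face

Support file of the one-cut programme (crux `NoHeavyLowerTail`, stmt-CriticalPhenomena-4575; lemma factory `prim-lf-1` gen 35, memo
`FROM-prim-lf-1-gen35-SPLICE-FORM-AND-HYBRID-LAW.md` §2.7).  Write `A ≼ A'` ("`A'` dominates `A` upward") when `#(U ∩ A) ≤ #(U ∩ A')` for every
up-set `U` — by Hall's theorem the existence of an upward injection `A ↪ A'`.  Kleitman's lemma is `refl W ≼ W` for an up-set `W`.  The universal matching of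
part II (`FiveUpSet.exists_universal_matching`) is equivalent to the following statement, the cleanest form of the three-set face of the five-up-set
inequality: for up-sets `B, X` there is a RESERVE `R ⊆ B ∩ X` with

  `refl (B ∩ X) ≼ (B ∩ refl X) + R ≼ B ∩ X`   (multiset sum in the middle),

i.e. adding a suitable part of the target up-set to the source family `B ∩ refl X` lands it between the antipodal family `refl (B ∩ X)` and `B ∩ X` in the
dominance order.  Here we prove it on cubes (`exists_sandwich`; `R` = the targets missed by the universal matching; `#R = #(B ∩ X) − #(B ∩ refl X)` is forced).
HONEST LABEL: a corollary/reformulation of part II (std axioms); on a general finite distributive lattice it is equivalent to the open face. [this work]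
-/

namespace Summit.CriticalPhenomena.PercolationContinuityZ3.Theorems

namespace FiveUpSet

open Finset

variable {α : Type} [DecidableEq α] [Fintype α]

/-- **SANDWICH form of the three-set face.**  For up-sets `B, X` of a finite cube there is `R ⊆ B ∩ X` such that for every up-set `U`:
`#(U ∩ refl (B ∩ X)) ≤ #(U ∩ (B ∩ refl X)) + #(U ∩ R)` and `#(U ∩ (B ∩ refl X)) + #(U ∩ R) ≤ #(U ∩ (B ∩ X))`
(so `refl (B ∩ X) ≼ (B ∩ refl X) + R ≼ B ∩ X` in the upward dominance order).  Proof: `R :=` the targets not hit by the universal matching `φ` of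
`exists_universal_matching`; the second inequality is injectivity of `φ` into `(B ∩ X) \ R` above `U`, the first is its crossing bound. [this work] -/
theorem exists_sandwich (B X : Finset (Finset α)) (hB : IsUpperSet (B : Set (Finset α))) (hX : IsUpperSet (X : Set (Finset α))) :
    ∃ R : Finset (Finset α), R ⊆ B ∩ X ∧ ∀ U : Finset (Finset α), IsUpperSet (U : Set (Finset α)) →
      (U ∩ refl (B ∩ X)).card ≤ (U ∩ (B ∩ refl X)).card + (U ∩ R).card ∧
      (U ∩ (B ∩ refl X)).card + (U ∩ R).card ≤ (U ∩ (B ∩ X)).card := by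
  classical
  obtain ⟨φ, hφ, hinj, hcross⟩ := exists_universal_matching B X hB hX
  set S : Finset (Finset α) := B ∩ refl X with hS
  set W : Finset (Finset α) := B ∩ X with hW
  refine ⟨W \ S.image φ, sdiff_subset, fun U hU => ?_⟩
  have himg : S.image φ ⊆ W := by
    intro t ht; rw [mem_image] at ht; obtain ⟨s, hs, rfl⟩ := ht; exact (hφ s hs).1
  -- targets in `U` hit by `φ`: images of sources in `U` plus edges entering `U`
  set C : Finset (Finset α) := S.filter (fun s => s ∉ U ∧ φ s ∈ U) with hC
  set I : Finset (Finset α) := S.filter (fun s => s ∈ U) with hI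
  have hIU : I = U ∩ S := by
    ext s; simp only [hI, mem_filter, mem_inter]; tauto
  have hhit : (U ∩ S.image φ).card = I.card + C.card := by
    have e : U ∩ S.image φ = (I ∪ C).image φ := by
      ext t
      simp only [mem_inter, mem_image, mem_union, hI, hC, mem_filter]
      constructor
      · rintro ⟨htU, s, hs, rfl⟩
        by_cases hsU : s ∈ U
        · exact ⟨s, Or.inl ⟨hs, hsU⟩, rfl⟩
        · exact ⟨s, Or.inr ⟨hs, hsU, htU⟩, rfl⟩
      · rintro ⟨s, hs, rfl⟩
        rcases hs with ⟨hs, hsU⟩ | ⟨hs, -, ht⟩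
        · exact ⟨hU (hφ s hs).2 hsU, s, hs, rfl⟩
        · exact ⟨ht, s, hs, rfl⟩
    have hdisj : Disjoint I C := by
      rw [disjoint_left]; intro s hsI hsC
      rw [hI, mem_filter] at hsI; rw [hC, mem_filter] at hsC
      exact hsC.2.1 hsI.2
    rw [e, card_image_of_injOn, card_union_of_disjoint hdisj]
    intro s hs s' hs' h
    have m : ∀ s ∈ ((I ∪ C : Finset (Finset α)) : Set (Finset α)), s ∈ S := by
      intro s hs; rw [mem_coe, mem_union, hI, hC, mem_filter, mem_filter] at hs
      rcases hs with h | h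
      · exact h.1
      · exact h.1
    exact hinj (mem_coe.2 (m s hs)) (mem_coe.2 (m s' hs')) h
  -- the reserve inside `U`
  have hRU : (U ∩ (W \ S.image φ)).card + (U ∩ S.image φ).card = (U ∩ W).card := by
    have e : U ∩ W = (U ∩ (W \ S.image φ)) ∪ (U ∩ S.image φ) := by
      ext t; simp only [mem_inter, mem_union, mem_sdiff]
      constructor
      · rintro ⟨htU, htW⟩
        by_cases h : t ∈ S.image φ
        · exact Or.inr ⟨htU, h⟩
        · exact Or.inl ⟨htU, htW, h⟩
      · rintro (⟨htU, htW, -⟩ | ⟨htU, h⟩)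
        · exact ⟨htU, htW⟩
        · exact ⟨htU, himg h⟩
    have d : Disjoint (U ∩ (W \ S.image φ)) (U ∩ S.image φ) := by
      rw [disjoint_left]; intro t ht ht'
      rw [mem_inter, mem_sdiff] at ht; rw [mem_inter] at ht'
      exact ht.2.2 ht'.2
    rw [e, card_union_of_disjoint d]
  have hc := hcross U hU
  rw [← hC, inter_assoc, ← hW] at hc
  rw [← hIU]
  constructor
  · -- crossing bound: #C + #(U ∩ refl W) ≤ #(U ∩ W) = #(U ∩ R) + #I + #C
    omega
  · omega

end FiveUpSet

end Summit.CriticalPhenomena.PercolationContinuityZ3.Theorems
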